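import Mathlib.Data.Fin.Basic
import Mathlib.Logic.Function.Basic
import Mathlib.Order.Basic
import Mathlib.Tactic
import HarnessLib

/-!
# The schedule of the staircase corridors: one mover per level, within its gap

Topic: Probability / Percolation; family `crit-perc`. A brick of the GENERIC landing layer of
Nolin's arm-separation theorem (Nolin 2008, Thm. 11, §4.4 [arXiv 0711.4948: Thm. 10, p. 12]:
"we can extend the arms using RSW in corridors (Fig. 6)"), towards
`Literature.Probability.Percolation.Nolin2008_prop17_quasiMult` (`FiveArmExponentFacts.lean`).

`k` corridors must lead `k` exits (angular positions = keys `p j`, lifted to `ℤ`, sorted, at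
least `δ` apart, the last less than a full turn `C` ahead of the first) to `k` targets `T j`
(same shape, same cyclic order) WITHOUT CROSSING. The corridors are staircases over ring levels;
at each level exactly one corridor moves (along the ring), the others go straight up. This file
is the pure combinatorics of the SCHEDULE: a right-mover `j` (`p j < T j`) advances to
`min (T j) (right bound - δ)` (`stepR`), a right sweep processes the movers `k-1, …, 0`
(`procR`, `sweepR`); every move keeps the row sorted, `δ`-separated and within a turn (`Inv`,
`inv_stepR`) — so the corridors of one level are pairwise disjoint — and TWO right sweeps bring
every right-mover to its target (`sweepR_sweepR_eq_target`: after one sweep each mover sits at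
its target or `δ` behind its right neighbour; the chain bound `sweepR_lower` then lets the last
index, and after it all the others, finish in the second sweep). Left-movers are finished by two
left sweeps, by reflection (`sweepL_sweepL_eq_target`); non-movers never move
(`procR_apply_of_target_le`). In all `4k` levels suffice.

## Main definitions

* `Staircase.Inv C δ p`, `Staircase.rb`, `Staircase.stepR`, `Staircase.procR`, `Staircase.sweepR`,
  `Staircase.refl`, `Staircase.sweepL`.

## Main results

* `Staircase.inv_stepR`, `Staircase.inv_procR`, `Staircase.le_procR`, `Staircase.procR_shape`,
  `Staircase.sweepR_lower`, `Staircase.sweepR_sweepR_eq_target`, `Staircase.sweepL_sweepL_eq_target`.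

## References

* P. Nolin, *Near-critical percolation in two dimensions*, Electron. J. Probab. 13 (2008), §4.4
  (arXiv 0711.4948: proof of Thm. 10, p. 12, Fig. 6). [Nolin2008]
* H. Kesten, *Scaling relations for 2D-percolation*, Comm. Math. Phys. 109 (1987), Lemma 4.
  [Kesten1987]
-/

namespace Literature.Probability.Percolation

namespace Staircase

variable {k : ℕ} (C δ : ℤ) (T : Fin k → ℤ)

/-- **The invariant of a row of positions**: consecutive positions at least `δ` apart, the last
less than a full turn `C` ahead of the first (gap `δ` included). [folklore] -/
def Inv (p : Fin k → ℤ) : Prop :=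
  (∀ i j : Fin k, i.val + 1 = j.val → p i + δ ≤ p j) ∧ (∀ i j : Fin k, i.val + 1 = k → j.val = 0 → p i + δ ≤ p j + C)

/-- The right bound of the index `j`: the next position, or the first one a full turn ahead. [folklore] -/
def rb (p : Fin k → ℤ) (j : Fin k) : ℤ :=
  if h : j.val + 1 < k then p ⟨j.val + 1, h⟩ else p ⟨0, lt_of_le_of_lt (Nat.zero_le _) j.isLt⟩ + C

/-- **One right move**: the mover `j` (if it is a right-mover, `p j < T j`) advances to its target
or to `δ` behind its right bound. [cite: Nolin2008, §4.4 (arXiv 0711.4948: proof of Thm. 10, p. 12, Fig. 6: "RSW in corridors")] -/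
def stepR (p : Fin k → ℤ) (j : Fin k) : Fin k → ℤ :=
  Function.update p j (if p j < T j then min (T j) (rb C p j - δ) else p j)

/-- **A right sweep, first `n` moves**: the movers `k-1, k-2, …, k-n` in this order. [folklore] -/
def procR (p : Fin k → ℤ) : ℕ → (Fin k → ℤ)
  | 0 => p
  | n + 1 => if h : n < k then stepR C δ T (procR p n) ⟨k - 1 - n, by omega⟩ else procR p n

/-- **A right sweep.** [folklore] -/
def sweepR (p : Fin k → ℤ) : Fin k → ℤ := procR C δ T p k

variable {C δ T}

/-- The recursion of `procR`. [folklore] -/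
theorem procR_succ (p : Fin k → ℤ) (n : ℕ) :
    procR C δ T p (n + 1) = if h : n < k then stepR C δ T (procR C δ T p n) ⟨k - 1 - n, by omega⟩ else procR C δ T p n :=
  rfl

/-! ### One move -/

section Step

variable {p : Fin k → ℤ} {j : Fin k}

/-- The mover's new position. [folklore] -/
theorem stepR_apply_self : stepR C δ T p j j = if p j < T j then min (T j) (rb C p j - δ) else p j := by
  simp [stepR]

/-- The other positions are unchanged. [folklore] -/
theorem stepR_apply_ne {i : Fin k} (h : i ≠ j) : stepR C δ T p j i = p i := by
  simp [stepR, Function.update_of_ne h]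

/-- A move does not move non-right-movers. [folklore] -/
theorem stepR_eq_self_of_le (h : T j ≤ p j) : stepR C δ T p j j = p j := by
  rw [stepR_apply_self, if_neg (not_lt.2 h)]

/-- The right bound is at least `δ` ahead under the invariant. [folklore] -/
theorem le_rb_sub (hI : Inv C δ p) (j : Fin k) : p j ≤ rb C p j - δ := by
  unfold rb
  split_ifs with h
  · have := hI.1 j ⟨j.val + 1, h⟩ rfl; omega
  · have := hI.2 j ⟨0, lt_of_le_of_lt (Nat.zero_le _) j.isLt⟩ (by omega) rfl; omega

/-- A move only advances the mover. [folklore] -/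
theorem le_stepR (hI : Inv C δ p) (i : Fin k) : p i ≤ stepR C δ T p j i := by
  by_cases h : i = j
  · subst h
    rw [stepR_apply_self]
    split_ifs with hlt
    · exact le_min hlt.le (le_rb_sub hI i)
    · exact le_rfl
  · rw [stepR_apply_ne h]

/-- A move never passes the target of a right-mover. [folklore] -/
theorem stepR_le_target (h : p j ≤ T j) : stepR C δ T p j j ≤ T j := by
  rw [stepR_apply_self]
  split_ifs with hlt
  · exact min_le_left _ _
  · exact h

/-- A move stays `δ` behind the right bound. [folklore] -/
theorem stepR_le_rb (hI : Inv C δ p) : stepR C δ T p j j ≤ rb C p j - δ := by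
  rw [stepR_apply_self]
  split_ifs with hlt
  · exact min_le_right _ _
  · exact le_rb_sub hI j

/-- **A move preserves the invariant.** [folklore] -/
theorem inv_stepR (hI : Inv C δ p) : Inv C δ (stepR C δ T p j) := by
  have hmono := le_stepR (T := T) (j := j) hI
  have hrb := stepR_le_rb (T := T) (j := j) hI
  refine ⟨fun i i' hii' => ?_, fun i i' hi hi' => ?_⟩
  · by_cases h1 : i = j
    · subst h1
      -- the mover against its right neighbour (unchanged)
      have hne : i' ≠ i := fun h => by subst h; omega
      rw [stepR_apply_ne hne]
      unfold rb at hrb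
      rw [dif_pos (show i.val + 1 < k by have := i'.isLt; omega)] at hrb
      have : (⟨i.val + 1, by have := i'.isLt; omega⟩ : Fin k) = i' := Fin.ext hii'
      rw [this] at hrb
      omega
    · rw [stepR_apply_ne h1]
      exact (hI.1 i i' hii').trans (by have := hmono i'; omega)
  · by_cases h1 : i = j
    · subst h1
      have hk : ¬ i.val + 1 < k := by omega
      unfold rb at hrb
      rw [dif_neg hk] at hrb
      by_cases h2 : i' = i
      · subst h2
        have := hI.2 _ _ hi hi'
        omega
      · rw [stepR_apply_ne h2]
        have : (⟨0, lt_of_le_of_lt (Nat.zero_le _) i.isLt⟩ : Fin k) = i' := Fin.ext hi'.symm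
        rw [this] at hrb
        omega
    · rw [stepR_apply_ne h1]
      exact (hI.2 i i' hi hi').trans (by have := hmono i'; omega)

end Step

/-! ### A right sweep -/

section Sweep

variable {p : Fin k → ℤ}

/-- The invariant along a sweep. [folklore] -/
theorem inv_procR (hI : Inv C δ p) : ∀ n, Inv C δ (procR C δ T p n)
  | 0 => hI
  | n + 1 => by
    unfold procR
    split_ifs with h
    · exact inv_stepR (inv_procR hI n)
    · exact inv_procR hI n

/-- Positions only advance along a sweep. [folklore] -/
theorem le_procR (hI : Inv C δ p) : ∀ n, ∀ i, p i ≤ procR C δ T p n i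
  | 0 => fun _ => le_rfl
  | n + 1 => fun i => by
    unfold procR
    split_ifs with h
    · exact (le_procR hI n i).trans (le_stepR (inv_procR hI n) i)
    · exact le_procR hI n i

/-- Indices not yet processed are unchanged. [folklore] -/
theorem procR_apply_of_lt (n : ℕ) (i : Fin k) (hi : i.val + n < k) : procR C δ T p n i = p i := by
  induction n with
  | zero => rfl
  | succ n ih =>
    unfold procR
    rw [dif_pos (by omega)]
    rw [stepR_apply_ne (fun h => by have := congrArg Fin.val h; simp at this; omega)]
    exact ih (by omega)

/-- Non-right-movers never move. [folklore] -/
theorem procR_apply_of_target_le (hI : Inv C δ p) (i : Fin k) (hi : T i ≤ p i) : ∀ n, procR C δ T p n i = p i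
  | 0 => rfl
  | n + 1 => by
    have ih := procR_apply_of_target_le hI i hi n
    unfold procR
    split_ifs with h
    · by_cases heq : (⟨k - 1 - n, by omega⟩ : Fin k) = i
      · rw [← heq] at ih ⊢
        rw [stepR_eq_self_of_le (by rw [ih]; exact heq ▸ hi), ih]
      · rw [stepR_apply_ne (Ne.symm heq), ih]
    · exact ih

/-- Right-movers never pass their targets. [folklore] -/
theorem procR_le_target (hI : Inv C δ p) (i : Fin k) (hi : p i ≤ T i) : ∀ n, procR C δ T p n i ≤ T i
  | 0 => hi
  | n + 1 => by
    have ih := procR_le_target hI i hi n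
    unfold procR
    split_ifs with h
    · by_cases heq : (⟨k - 1 - n, by omega⟩ : Fin k) = i
      · rw [← heq] at ih ⊢
        exact stepR_le_target ih
      · rw [stepR_apply_ne (Ne.symm heq)]
        exact ih
    · exact ih

/-- **The shape of a sweep**: the index processed at move `n + 1` (index `k - 1 - n`) ends at its
target, or `δ` behind the CURRENT value of its right bound, which does not change afterwards in
the sweep; it is then still short of its target. [folklore] -/
theorem procR_shape {n : ℕ} (hn : n < k) (m : ℕ) (hm : n + 1 ≤ m) (hmk : m ≤ k) :
    let j : Fin k := ⟨k - 1 - n, by omega⟩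
    procR C δ T p m j = procR C δ T p (n + 1) j ∧
    (T j ≤ p j ∧ procR C δ T p (n + 1) j = p j ∨
      procR C δ T p (n + 1) j = T j ∨
      (procR C δ T p (n + 1) j = rb C (procR C δ T p n) j - δ ∧ procR C δ T p (n + 1) j < T j)) := by
  intro j
  constructor
  · -- later moves touch smaller indices only
    induction m, hm using Nat.le_induction with
    | base => rfl
    | succ m hm ih =>
      have ih' := ih (by omega)
      show procR C δ T p (m + 1) j = _
      unfold procR
      rw [dif_pos (by omega), stepR_apply_ne (fun h => by have := congrArg Fin.val h; simp [j] at this; omega)]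
      exact ih'
  · show (T j ≤ p j ∧ procR C δ T p (n + 1) j = p j) ∨ _
    have hprev : procR C δ T p n j = p j := procR_apply_of_lt n j (by simp [j]; omega)
    have e : procR C δ T p (n + 1) j = stepR C δ T (procR C δ T p n) j j := by
      rw [procR_succ, dif_pos hn]
    rw [e, stepR_apply_self, hprev]
    by_cases hlt : p j < T j
    · rw [if_pos hlt]
      right
      by_cases hle : T j ≤ rb C (procR C δ T p n) j - δ
      · left; exact min_eq_left hle
      · right
        push Not at hle
        exact ⟨min_eq_right hle.le, by rw [min_eq_right hle.le]; exact hle⟩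
    · rw [if_neg hlt]
      left; exact ⟨not_lt.1 hlt, rfl⟩

/-! ### Two right sweeps finish the right-movers -/

/-- Targets with the invariant: `T_{k-1} - C + (j + 1) δ ≤ T_j`. [folklore] -/
theorem target_lower (hT : Inv C δ T) (hk : 0 < k) (j : ℕ) (hj : j < k) :
    T ⟨k - 1, by omega⟩ - C + ((j : ℤ) + 1) * δ ≤ T ⟨j, hj⟩ := by
  have hchain : ∀ j (hj : j < k), T ⟨0, hk⟩ + j * δ ≤ T ⟨j, hj⟩ := by
    intro j
    induction j with
    | zero => intro hj; simp
    | succ j ihj =>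
      intro hj
      have := hT.1 ⟨j, by omega⟩ ⟨j + 1, hj⟩ rfl
      have := ihj (by omega)
      push_cast; linarith
  have hwrap := hT.2 ⟨k - 1, by omega⟩ ⟨0, hk⟩ (show k - 1 + 1 = k by omega) rfl
  have h1 := hchain j hj
  have e : ((j : ℤ) + 1) * δ = j * δ + δ := by ring
  linarith

/-- **Lower bound after one sweep**: the position of the index `k - 1 - n` is at least
`T_{k-1} - C + (k - n) δ` (targets with the invariant, `kδ ≤ C`, and the last target less than
two turns ahead: `T_{k-1} ≤ p₀ + 2C - (k+1)δ`). [folklore] -/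
theorem sweepR_lower (hT : Inv C δ T) (hkδ : (k : ℤ) * δ ≤ C) (hk : 0 < k)
    (hTk : T ⟨k - 1, by omega⟩ ≤ p ⟨0, hk⟩ + 2 * C - ((k : ℤ) + 1) * δ) :
    ∀ n (hn : n < k), T ⟨k - 1, by omega⟩ - C + ((k : ℤ) - n) * δ ≤ sweepR C δ T p ⟨k - 1 - n, by omega⟩ := by
  intro n
  induction n with
  | zero =>
    intro hn
    obtain ⟨hfix, hshape⟩ := procR_shape (C := C) (δ := δ) (T := T) (p := p) hn k (by omega) le_rfl
    have hlast : (⟨k - 1 - 0, by omega⟩ : Fin k) = ⟨k - 1, by omega⟩ := Fin.ext rfl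
    rw [hlast] at hfix hshape ⊢
    have e0 : ((k : ℤ) - ((0 : ℕ) : ℤ)) * δ = k * δ := by push_cast; ring
    rw [e0]
    show _ ≤ procR C δ T p k _
    rw [hfix]
    rcases hshape with ⟨h1, h2⟩ | h | ⟨h, -⟩
    · rw [h2]; linarith
    · rw [h]; linarith
    · rw [h]
      unfold rb
      rw [dif_neg (show ¬ (k - 1 + 1 < k) by omega)]
      change _ ≤ p ⟨0, _⟩ + C - δ
      have e1 : ((k : ℤ) + 1) * δ = k * δ + δ := by ring
      linarith
  | succ n ih =>
    intro hn
    have ih' := ih (by omega)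
    obtain ⟨hfix, hshape⟩ := procR_shape (C := C) (δ := δ) (T := T) (p := p) hn k (by omega) le_rfl
    -- the right neighbour `k - 1 - n`, fixed after its move
    obtain ⟨hfixR, -⟩ := procR_shape (C := C) (δ := δ) (T := T) (p := p) (show n < k by omega) k (by omega) le_rfl
    have hTj := target_lower hT hk (k - 1 - (n + 1)) (by omega)
    have ej : (((k - 1 - (n + 1) : ℕ) : ℤ) + 1) * δ = ((k : ℤ) - ((n + 1 : ℕ) : ℤ)) * δ := by
      rw [Nat.cast_sub (by omega), Nat.cast_sub (by omega)]; push_cast; ring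
    rw [ej] at hTj
    show _ ≤ procR C δ T p k _
    rw [hfix]
    rcases hshape with ⟨h1, h2⟩ | h | ⟨h, -⟩
    · rw [h2]; exact hTj.trans h1
    · rw [h]; exact hTj
    · rw [h]
      unfold rb
      rw [dif_pos (show k - 1 - (n + 1) + 1 < k by omega)]
      have eidx : (⟨(⟨k - 1 - (n + 1), by omega⟩ : Fin k).val + 1, show k - 1 - (n + 1) + 1 < k by omega⟩ : Fin k) =
          ⟨k - 1 - n, by omega⟩ := Fin.ext (show k - 1 - (n + 1) + 1 = k - 1 - n by omega)
      rw [eidx, ← hfixR]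
      have := ih'
      unfold sweepR at this
      have ed : ((k : ℤ) - (n : ℕ)) * δ = ((k : ℤ) - ((n + 1 : ℕ) : ℤ)) * δ + δ := by push_cast; ring
      linarith

/-- **Two right sweeps finish the right-movers**: after `sweepR ∘ sweepR` every index `j` with
`p j ≤ T j` sits at its target (`T` with the invariant, `kδ ≤ C`, `T_{k-1} ≤ p₀ + 2C - (k+1)δ`);
the other indices never move (`procR_apply_of_target_le`). [cite: Nolin2008, §4.4 (arXiv 0711.4948: proof of Thm. 10, p. 12, Fig. 6)] -/
theorem sweepR_sweepR_eq_target (hI : Inv C δ p) (hT : Inv C δ T) (hkδ : (k : ℤ) * δ ≤ C) (hk : 0 < k)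
    (hTk : T ⟨k - 1, by omega⟩ ≤ p ⟨0, hk⟩ + 2 * C - ((k : ℤ) + 1) * δ) :
    ∀ j : Fin k, p j ≤ T j → sweepR C δ T (sweepR C δ T p) j = T j := by
  set q := sweepR C δ T p with hq
  have hIq : Inv C δ q := inv_procR hI k
  have hqT : ∀ j : Fin k, p j ≤ T j → q j ≤ T j := fun j hj => procR_le_target hI j hj k
  have hqfix : ∀ j : Fin k, T j ≤ p j → q j = p j := fun j hj => procR_apply_of_target_le hI j hj k
  have hq0 : T ⟨k - 1, by omega⟩ ≤ q ⟨0, hk⟩ + C - δ := by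
    have := sweepR_lower hT hkδ hk hTk (k - 1) (by omega)
    have e : (⟨k - 1 - (k - 1), by omega⟩ : Fin k) = ⟨0, hk⟩ := Fin.ext (by simp)
    rw [e] at this
    have e2 : ((k : ℤ) - ((k - 1 : ℕ) : ℤ)) * δ = δ := by rw [Nat.cast_sub (by omega : 1 ≤ k)]; push_cast; ring
    rw [e2] at this
    linarith
  -- by induction along the second sweep
  suffices H : ∀ n (hn : n < k), p ⟨k - 1 - n, by omega⟩ ≤ T ⟨k - 1 - n, by omega⟩ →
      sweepR C δ T q ⟨k - 1 - n, by omega⟩ = T ⟨k - 1 - n, by omega⟩ by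
    intro j hj
    have e : j = ⟨k - 1 - (k - 1 - j.val), by omega⟩ := Fin.ext (show j.val = k - 1 - (k - 1 - j.val) by omega)
    rw [e] at hj ⊢
    exact H _ (by omega) hj
  intro n
  induction n with
  | zero =>
    intro hn hpj
    obtain ⟨hfix, hshape⟩ := procR_shape (C := C) (δ := δ) (T := T) (p := q) hn k (by omega) le_rfl
    show procR C δ T q k _ = _
    rw [hfix]
    rcases hshape with ⟨h1, h2⟩ | h | ⟨h, hlt⟩
    · rw [h2]; exact le_antisymm (hqT _ hpj) h1
    · exact h
    · exfalso
      rw [h] at hlt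
      unfold rb at hlt
      rw [dif_neg (show ¬ (k - 1 - 0 + 1 < k) by omega)] at hlt
      have e : (⟨k - 1 - 0, by omega⟩ : Fin k) = ⟨k - 1, by omega⟩ := Fin.ext rfl
      rw [e] at hlt
      change q ⟨0, _⟩ + C - δ < T ⟨k - 1, _⟩ at hlt
      linarith
  | succ n ih =>
    intro hn hpj
    obtain ⟨hfix, hshape⟩ := procR_shape (C := C) (δ := δ) (T := T) (p := q) hn k (by omega) le_rfl
    obtain ⟨hfixR, -⟩ := procR_shape (C := C) (δ := δ) (T := T) (p := q) (show n < k by omega) k (by omega) le_rfl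
    -- the right neighbour is at least at its target after its move
    have hnb : T ⟨k - 1 - n, by omega⟩ ≤ sweepR C δ T q ⟨k - 1 - n, by omega⟩ := by
      by_cases hp' : p ⟨k - 1 - n, by omega⟩ ≤ T ⟨k - 1 - n, by omega⟩
      · exact (ih (by omega) hp').ge
      · push Not at hp'
        have h1 : q ⟨k - 1 - n, by omega⟩ = p ⟨k - 1 - n, by omega⟩ := hqfix _ hp'.le
        have h2 : sweepR C δ T q ⟨k - 1 - n, by omega⟩ = q ⟨k - 1 - n, by omega⟩ :=
          procR_apply_of_target_le hIq _ (by rw [h1]; exact hp'.le) k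
        rw [h2, h1]; exact hp'.le
    have hgap := hT.1 ⟨k - 1 - (n + 1), by omega⟩ ⟨k - 1 - n, by omega⟩ (show k - 1 - (n + 1) + 1 = k - 1 - n by omega)
    show procR C δ T q k _ = _
    rw [hfix]
    rcases hshape with ⟨h1, h2⟩ | h | ⟨h, hlt⟩
    · rw [h2]; exact le_antisymm (hqT _ hpj) h1
    · exact h
    · exfalso
      rw [h] at hlt
      unfold rb at hlt
      rw [dif_pos (show k - 1 - (n + 1) + 1 < k by omega)] at hlt
      have eidx : (⟨(⟨k - 1 - (n + 1), by omega⟩ : Fin k).val + 1, show k - 1 - (n + 1) + 1 < k by omega⟩ : Fin k) =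
          ⟨k - 1 - n, by omega⟩ := Fin.ext (show k - 1 - (n + 1) + 1 = k - 1 - n by omega)
      rw [eidx, ← hfixR] at hlt
      change sweepR C δ T q ⟨k - 1 - n, _⟩ - δ < _ at hlt
      linarith

end Sweep

/-! ### Left sweeps, by reflection -/

section Left

variable (C δ T)

/-- The reflection of a row of positions: reverse the indices and negate. [folklore] -/
def refl (p : Fin k → ℤ) : Fin k → ℤ := fun j => -p (Fin.rev j)

/-- **A left sweep**: the reflection of a right sweep of the reflected row towards the reflected
targets (movers `0, 1, …, k-1`, each moving left to its target or to `δ` ahead of its left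
bound). [folklore] -/
def sweepL (p : Fin k → ℤ) : Fin k → ℤ := refl (sweepR C δ (refl T) (refl p))

variable {C δ T}

/-- The reflection is an involution. [folklore] -/
theorem refl_refl (p : Fin k → ℤ) : refl (refl p) = p := by
  ext j; simp [refl, Fin.rev_rev]

/-- The reflection preserves the invariant. [folklore] -/
theorem inv_refl {p : Fin k → ℤ} (hI : Inv C δ p) : Inv C δ (refl p) := by
  refine ⟨fun i j hij => ?_, fun i j hi hj => ?_⟩
  · have h := hI.1 (Fin.rev j) (Fin.rev i) (by rw [Fin.val_rev, Fin.val_rev]; omega)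
    simp only [refl]; omega
  · have h := hI.2 (Fin.rev j) (Fin.rev i) (by rw [Fin.val_rev]; omega) (by rw [Fin.val_rev]; omega)
    simp only [refl]; omega

/-- **Two left sweeps finish the left-movers** (`kδ ≤ C`, `p_{k-1} - 2C + (k+1)δ ≤ T₀`). [cite: Nolin2008, §4.4 (arXiv 0711.4948: proof of Thm. 10, p. 12, Fig. 6)] -/
theorem sweepL_sweepL_eq_target {p : Fin k → ℤ} (hI : Inv C δ p) (hT : Inv C δ T) (hkδ : (k : ℤ) * δ ≤ C) (hk : 0 < k)
    (hT0 : p ⟨k - 1, by omega⟩ - 2 * C + ((k : ℤ) + 1) * δ ≤ T ⟨0, hk⟩) :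
    ∀ j : Fin k, T j ≤ p j → sweepL C δ T (sweepL C δ T p) j = T j := by
  intro j hj
  have hlast : (Fin.rev (⟨k - 1, by omega⟩ : Fin k)) = ⟨0, hk⟩ := Fin.ext (by rw [Fin.val_rev]; show k - (k - 1 + 1) = 0; omega)
  have hzero : (Fin.rev (⟨0, hk⟩ : Fin k)) = ⟨k - 1, by omega⟩ := Fin.ext (by rw [Fin.val_rev])
  have hTk : refl T ⟨k - 1, by omega⟩ ≤ refl p ⟨0, hk⟩ + 2 * C - ((k : ℤ) + 1) * δ := by
    simp only [refl, hlast, hzero]; linarith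
  have h := sweepR_sweepR_eq_target (inv_refl hI) (inv_refl hT) hkδ hk hTk (Fin.rev j)
    (by simp only [refl, Fin.rev_rev]; linarith)
  unfold sweepL
  rw [refl_refl]
  simp only [refl] at h ⊢
  rw [h, Fin.rev_rev]
  ring

end Left

end Staircase

end Literature.Probability.Percolation
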